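import Mathlib
import Summits.KontsevichZagierPeriods.KontsevichZagierPeriods.Theorems.InverseLandauTateFamilyKernelOpenCube
import Summits.KontsevichZagierPeriods.KontsevichZagierPeriods.Theorems.InverseLandauTateFamilyKernelTateAnchor
import Summits.KontsevichZagierPeriods.KontsevichZagierPeriods.Theorems.InverseLandauTateFamilyKernelStubExactFibreTwo
import Summits.KontsevichZagierPeriods.KontsevichZagierPeriods.Theorems.InverseLandauTateFamilyKernelStubLinDensity
import Summits.KontsevichZagierPeriods.KontsevichZagierPeriods.Theorems.InverseLandauTateFamilyKernelStubLinResidues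
import Summits.KontsevichZagierPeriods.KontsevichZagierPeriods.Theorems.InverseLandauTateFamilyKernelStubLinMomentsW
import Summits.KontsevichZagierPeriods.KontsevichZagierPeriods.Theorems.InverseLandauTateFamilyKernelStubLinExactW

/-!
# Crux `TateFamilyKernel` (stmt-KontsevichZagierPeriods-9130), line `Sketch` — the LINEAR CLASS with an
arbitrary numerator is a proved sector

`Q = 1 − ϖ(α + βz₂)z₁` (`α, β ∈ ℚ_{>0}`), ANY `P ∈ ℚ[z₁, z₂, ϖ]`: admissibility and identical vanishing of
`∫_{(0,1)²} P/Q(z,ϖ) dz` on `(0,b)` imply that every tame cube representation of every real-algebraic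
fibre is a Kontsevich–Zagier relation: `stub_linMomentsW` (reversed polynomial `P̃`) → `stub_linDensity`,
`stub_linResidues` (applied to `P̃`) → `stub_linExactW` → `stub_exactFibreTwo`.
-/

noncomputable section

open MeasureTheory Set MvPolynomial
open Literature.NumberTheory.Transcendental

namespace Summit.KontsevichZagierPeriods.InverseLandau.TateFamilyKernel.Descent

/-- **The linear class with an arbitrary numerator is a proved sector of the crux** (dimension 2).
[cite: KontsevichZagier2001, §1.2] [cite: Baker1975, Thm. 2.1] -/
theorem linClassW_mem_relations (α β : ℚ) (P : MvPolynomial (Fin (2 + 1)) ℚ) (b : ℝ)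
    (hα : 0 < α) (hβ : 0 < β)
    (hadm : ∀ (z : Fin 2 → ℝ) (ϖ : ℝ), (∀ t, z t ∈ Icc (0 : ℝ) 1) → ϖ ∈ Ioo 0 b →
      aeval (Fin.snoc z ϖ : Fin (2 + 1) → ℝ)
        (1 - X (Fin.last 2) * (C α + C β * X 1) * X 0 : MvPolynomial (Fin (2 + 1)) ℚ) ≠ 0)
    (hvan : ∀ ϖ ∈ Ioo 0 b, ∫ z in Set.pi Set.univ (fun _ : Fin 2 => Ioo (0 : ℝ) 1),
      aeval (Fin.snoc z ϖ : Fin (2 + 1) → ℝ) P /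
        aeval (Fin.snoc z ϖ : Fin (2 + 1) → ℝ)
          (1 - X (Fin.last 2) * (C α + C β * X 1) * X 0 : MvPolynomial (Fin (2 + 1)) ℚ) = 0)
    (ϖ₀ : ℝ) (halg : IsAlgebraic ℚ ϖ₀) (hϖ₀ : ϖ₀ ∈ Ioo 0 b)
    (Φ : KZ.IntegralRep 2) (hΦ : Φ.IsTameCube)
    (hΦi : ∀ z ∈ KZ.cube 2, Φ.integrand z =
      aeval (Fin.snoc z ϖ₀ : Fin (2 + 1) → ℝ) P /
        aeval (Fin.snoc z ϖ₀ : Fin (2 + 1) → ℝ)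
          (1 - X (Fin.last 2) * (C α + C β * X 1) * X 0 : MvPolynomial (Fin (2 + 1)) ℚ)) :
    KZ.of Φ ∈ KZ.relations := by
  have hb : 0 < b := hϖ₀.1.trans hϖ₀.2
  obtain ⟨M₀, Pt, hPt, hmom⟩ := stub_linMomentsW α β P b hα hβ hb hadm hvan
  have hden := stub_linDensity α β Pt hα hβ hmom
  obtain ⟨k, M, hM⟩ := stub_linResidues α β Pt hα hβ hden
  have hQ : ∀ w ∈ KZ.cube 2, aeval (Fin.snoc w ϖ₀ : Fin (2 + 1) → ℝ)
      (1 - X (Fin.last 2) * (C α + C β * X 1) * X 0 : MvPolynomial (Fin (2 + 1)) ℚ) ≠ 0 :=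
    fun w hw => hadm w ϖ₀ (fun t => hw t) hϖ₀
  obtain ⟨K, i, A, Dn, hDn, hexact⟩ := stub_linExactW α β P hα hβ M₀ Pt hPt k M hM ϖ₀ hϖ₀.1 hQ
  exact stub_exactFibreTwo K i P _ A Dn ϖ₀ halg hQ hDn hexact (hvan ϖ₀ hϖ₀) Φ hΦ hΦi

/-- The same in the crux's own binders (`n = 2`, open-cube representation). [cite: KontsevichZagier2001, §1.2] -/
theorem linClassW_openCube_mem_relations (α β : ℚ) (P : MvPolynomial (Fin (2 + 1)) ℚ) (b : ℝ)
    (hα : 0 < α) (hβ : 0 < β)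
    (hadm : ∀ (z : Fin 2 → ℝ) (ϖ : ℝ), (∀ t, z t ∈ Icc (0 : ℝ) 1) → ϖ ∈ Ioo 0 b →
      aeval (Fin.snoc z ϖ : Fin (2 + 1) → ℝ)
        (1 - X (Fin.last 2) * (C α + C β * X 1) * X 0 : MvPolynomial (Fin (2 + 1)) ℚ) ≠ 0)
    (hvan : ∀ ϖ ∈ Ioo 0 b, ∫ z in Set.pi Set.univ (fun _ : Fin 2 => Ioo (0 : ℝ) 1),
      aeval (Fin.snoc z ϖ : Fin (2 + 1) → ℝ) P /
        aeval (Fin.snoc z ϖ : Fin (2 + 1) → ℝ)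
          (1 - X (Fin.last 2) * (C α + C β * X 1) * X 0 : MvPolynomial (Fin (2 + 1)) ℚ) = 0)
    (ϖ₀ : ℝ) (halg : IsAlgebraic ℚ ϖ₀) (hϖ₀ : ϖ₀ ∈ Ioo 0 b)
    (r : KZ.IntegralRep 2) (hd : r.domain = Set.pi Set.univ (fun _ : Fin 2 => Ioo (0 : ℝ) 1))
    (hi : EqOn r.integrand (fun z => aeval (Fin.snoc z ϖ₀ : Fin (2 + 1) → ℝ) P /
        aeval (Fin.snoc z ϖ₀ : Fin (2 + 1) → ℝ)
          (1 - X (Fin.last 2) * (C α + C β * X 1) * X 0 : MvPolynomial (Fin (2 + 1)) ℚ)) r.domain) :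
    KZ.of r ∈ KZ.relations := by
  have hQ : ∀ w ∈ KZ.cube 2, aeval (Fin.snoc w ϖ₀ : Fin (2 + 1) → ℝ)
      (1 - X (Fin.last 2) * (C α + C β * X 1) * X 0 : MvPolynomial (Fin (2 + 1)) ℚ) ≠ 0 :=
    fun w hw => hadm w ϖ₀ (fun t => hw t) hϖ₀
  obtain ⟨Φ, hΦ, hΦi⟩ := exists_isTameCube_fibre P _ halg hQ
  have hΦrel : KZ.of Φ ∈ KZ.relations :=
    linClassW_mem_relations α β P b hα hβ hadm hvan ϖ₀ halg hϖ₀ Φ hΦ (fun z _ => by rw [hΦi])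
  exact of_mem_relations_of_isTameCube hΦ hΦrel r hd (fun z hz => by rw [hΦi]; exact hi hz)

end Summit.KontsevichZagierPeriods.InverseLandau.TateFamilyKernel.Descent
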